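import Literature.NumberTheory.LFunctions.IdealMoebius
import Literature.NumberTheory.LFunctions.DirichletLFunctionBounds
import Literature.NumberTheory.LFunctions.PrimeIdealTheoremProofs
import HarnessLib

/-!
# Dirichlet coefficients of twisted `L`-functions of a number field: `ν`, `νΛ`, `νμ` grouped by norm

Topic `Literature/NumberTheory/LFunctions`, next to `IdealMoebius.lean` (`μ_K`, `ζ_K · L(μ_K) = 1`),
`DedekindZetaVonMangoldt.lean` (`Λ_K`, `−ζ_K'/ζ_K`) and `TwistedZeroFreeRegion.lean` (the abstract
hypotheses `TwistedZFRData` of the zero-free region for a twisted `L`-function). Everything here is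
PROVED (definitions with bodies + theorems; no named facts).

**Purpose.** For a number field `K` and a completely multiplicative function
`ν : Ideal(𝓞_K) →*₀ ℂ` on ideals with `|ν| ≤ 1` (model: a Hecke character — a ray-class character
times a Grössencharakter — extended by `0` to the ideals not prime to the conductor; for
`K = ℚ(∛2)`, Heath-Brown's `ν₀ν₁^jν₂^k`, *Primes represented by `x³ + 2y³`*, Acta Math. 186 (2001),
(9.2), via class number one) the `L`-function `L(s, ν) = ∑_𝔞 ν(𝔞) N𝔞^{-s}` and its logarithmic
derivative are ordinary Dirichlet series in `n = N𝔞`. This file supplies their coefficients and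
the algebra that the analytic files consume (the fields `nonneg … three_four_one`, `ne_zero`,
`logDeriv_eq`, `lower`, `norm_le₁`, `norm_le₂` of `TwistedZFRData`, and the majorants needed by
`LogRieszMeanConductor.lean`):

* `idealVonMangoldt` — the von Mangoldt function **on ideals**, `Λ(P^m) = log N P` (`m ≥ 1`), `0`
  otherwise; `sum_divisors_idealVonMangoldt`: `∑_{B ∣ J} Λ(B) = log N J`;
* `trivialChar K` — the trivial character `𝔞 ↦ [𝔞 ≠ 0]`;
* `twistCount ν n = ∑_{N𝔞 = n} ν(𝔞)` (`= L`-coefficients of `L(s, ν)`),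
  `twistVonMangoldt ν n = ∑_{N𝔞 = n} ν(𝔞)Λ(𝔞)` (of `−L'/L(s, ν)`),
  `twistMoebius ν n = ∑_{N𝔞 = n} μ_K(𝔞)ν(𝔞)` (of `1/L(s, ν)`), `vonMangoldtNorm K n = ∑_{N𝔞 = n} Λ(𝔞)`
  (real, `≥ 0`; `= twistVonMangoldt (trivialChar K)`);
* the convolution identities `twistVonMangoldt ν ⋆ twistCount ν = twistCount ν · log` and
  `twistMoebius ν ⋆ twistCount ν = δ` (`sum_divisorsAntidiagonal_regroup'`, complete multiplicativity
  `ν(BA) = ν(B)ν(A)`, and the divisor sums of `Λ`, `μ_K`);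
* the `L`-series consequences on `σ > 1`: absolute convergence, `L(twistMoebius ν)·L(twistCount ν) = 1`,
  `L(twistCount ν, s) ≠ 0`, `(L(twistCount ν))' = −L(twistCount ν)·L(twistVonMangoldt ν)`,
  `L(twistCount (trivialChar K)) = ζ_K`, `L(vonMangoldtNorm K) = −ζ_K'/ζ_K = L(Λ_K)`, the lower bound
  `c_K (σ − 1) ≤ ‖L(twistCount ν, s)‖` for `1 < σ ≤ 2` with `c_K` depending on `K` only, and
  `Re L(vonMangoldtNorm K, σ) ≤ 1/(σ−1) + K₀`;
* the `3-4-1` positivity `3 Re L(Λ_K, σ) + 4 Re L(νΛ, σ+it) + Re L(ν²Λ, σ+2it) ≥ 0`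
  (Montgomery–Vaughan Lemma 11.2 over `K`: the `𝔞`-th term is `Λ(𝔞)N𝔞^{-σ}(3 + 4Re w + Re w²)`,
  `w = ν(𝔞)N𝔞^{-it}`).

## References

* H. L. Montgomery, R. C. Vaughan, *Multiplicative Number Theory I*, CUP 2007, §11.1 Lemma 11.2,
  p. 277. [cite: MontgomeryVaughan2007, §11.1 Lemma 11.2]
* E. Landau, *Neuer Beweis des Primzahlsatzes und Beweis des Primidealsatzes*, Math. Ann. 56 (1903),
  §11 (`−ζ_κ'/ζ_κ = ∑ L_κ(n)n^{-s}`). [cite: LandauMathAnn1903, §11 p. 668]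
* D. R. Heath-Brown, *Primes represented by `x³ + 2y³`*, Acta Math. 186 (2001), §9 (9.1)–(9.2),
  Lemma 9.4. [cite: HeathBrownActa2001, §9 (9.2)]
* I. Mitsui, *Generalized prime number theorem*, Jap. J. Math. 26 (1956), Lemma 5. [cite: Mitsui1956, Lemma 5]

## Mathlib / tree search

Tree: `idealsOfNorm`, `mem_idealsOfNorm`, `card_idealsOfNorm`, `idealsOfNorm_one`
(`DedekindZetaVonMangoldt`), `idealMoebius`, `sum_idealMoebius_of_dvd`, `mem_filter_dvd_iff`,
`idealsOfNorm_zero` (`IdealMoebius`; its `sum_divisorsAntidiagonal_regroup` in `IdealMoebiusCoprime`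
is `ℤ`-valued — re-proved here for any `AddCommMonoid`), `LSeriesSummable_idealNormCount`,
`dedekindZeta_eq_LSeries`, `neg_logDeriv_dedekindZeta_eq`, `dedekindZeta_ne_zero_of_one_lt_re`,
`classicalZFRData_of_isLandauContinuation`, `exists_isLandauContinuation_holds`,
`ClassicalZFRData.exists_bound_LSeries`, `DirichletZFR.three_four_one_re_nonneg`,
`DirichletZFR.norm_mul_cpow_neg_le`. Mathlib: `Finset.prod_multiset_count`,
`UniqueFactorizationMonoid.prod_normalizedFactors`, `normalizedFactors_pow`, `normalizedFactors_irreducible`,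
`normalize_eq`, `associated_iff_eq`, `dvd_iff_normalizedFactors_le_normalizedFactors`,
`Finset.sum_bij_ne_zero`, `LSeries_convolution'`, `LSeries_deriv`, `LSeries_delta`, `LSeries_congr`.
No twisted/Hecke coefficients over a general number field in Mathlib or the tree
(`lean search 'twistCount|HeckeChar.*LSeries|Ideal.*→\*₀ ℂ'`; `GaussianHecke*` is `ℤ[i]`-specific).
-/

noncomputable section

open UniqueFactorizationMonoid Finset Complex
open scoped NumberField LSeries.notation

namespace Literature.NumberTheory.LFunctions

/-! ## The von Mangoldt function on the ideals of a Dedekind domain -/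

section Dedekind

variable {R : Type*} [CommRing R] [IsDedekindDomain R]

open scoped Classical in
/-- The **von Mangoldt function on ideals**: `Λ(J) = log N(P)` if `J = P^m` is a power (`m ≥ 1`) of a
single prime ideal `P`, and `Λ(J) = 0` otherwise (in particular `Λ(0) = Λ(1) = 0`). Written through
the finset of distinct prime factors: `Λ(J) = ∑_{P ∣ J prime} log N(P)` if that finset is a
singleton, else `0`. [cite: LandauMathAnn1903, §11 p. 668] -/
def idealVonMangoldt [Module.Free ℤ R] [Module.Finite ℤ R] (J : Ideal R) : ℝ :=
  if (normalizedFactors J).toFinset.card = 1 then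
    ∑ P ∈ (normalizedFactors J).toFinset, Real.log (Ideal.absNorm P) else 0

variable [Module.Free ℤ R] [Module.Finite ℤ R]

/-- `Λ ≥ 0`. [folklore] -/
theorem idealVonMangoldt_nonneg (J : Ideal R) : 0 ≤ idealVonMangoldt J := by
  classical
  unfold idealVonMangoldt
  split_ifs
  · exact Finset.sum_nonneg fun P _ ↦ Real.log_natCast_nonneg _
  · exact le_rfl

omit [Module.Free ℤ R] [Module.Finite ℤ R] in
/-- The normalized factors of `P^m`, `P` prime: `m` copies of `P`. [folklore] -/
theorem normalizedFactors_prime_pow {P : Ideal R} (hP : Prime P) (m : ℕ) :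
    normalizedFactors (P ^ m) = Multiset.replicate m P := by
  classical
  rw [normalizedFactors_pow, normalizedFactors_irreducible hP.irreducible, normalize_eq,
    Multiset.nsmul_singleton]

/-- **`Λ(P^m) = log N(P)`** for a prime ideal `P` and `m ≥ 1`. [folklore] -/
theorem idealVonMangoldt_prime_pow {P : Ideal R} (hP : Prime P) {m : ℕ} (hm : m ≠ 0) :
    idealVonMangoldt (P ^ m) = Real.log (Ideal.absNorm P) := by
  classical
  unfold idealVonMangoldt
  have h : (normalizedFactors (P ^ m)).toFinset = {P} := by
    rw [normalizedFactors_prime_pow hP, Multiset.toFinset_replicate, if_neg hm]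
  rw [h, Finset.card_singleton, if_pos rfl, Finset.sum_singleton]

/-- `Λ(J) = 0` unless `J` has exactly one distinct prime factor. [folklore] -/
theorem idealVonMangoldt_eq_zero {J : Ideal R} (h : (normalizedFactors J).toFinset.card ≠ 1) :
    idealVonMangoldt J = 0 := by
  classical
  unfold idealVonMangoldt
  rw [if_neg h]

/-- `Λ(0) = 0`. [folklore] -/
theorem idealVonMangoldt_bot : idealVonMangoldt (⊥ : Ideal R) = 0 := by
  apply idealVonMangoldt_eq_zero
  rw [← Ideal.zero_eq_bot, normalizedFactors_zero, Multiset.toFinset_zero, Finset.card_empty]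
  exact zero_ne_one

/-- `Λ(1) = 0`. [folklore] -/
theorem idealVonMangoldt_top : idealVonMangoldt (⊤ : Ideal R) = 0 := by
  apply idealVonMangoldt_eq_zero
  rw [← Ideal.one_eq_top, normalizedFactors_one, Multiset.toFinset_zero, Finset.card_empty]
  exact zero_ne_one

omit [Module.Free ℤ R] [Module.Finite ℤ R] in
/-- An ideal with exactly one distinct prime factor is a prime power: `J = P^m` with
`P ∈ normalizedFactors J` and `m = #normalizedFactors J ≥ 1`. [folklore] -/
theorem eq_prime_pow_of_card_eq_one {J : Ideal R} (h : (normalizedFactors J).toFinset.card = 1) :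
    ∃ P : Ideal R, Prime P ∧ (normalizedFactors J).toFinset = {P} ∧
      normalizedFactors J = Multiset.replicate (Multiset.card (normalizedFactors J)) P ∧
      0 < Multiset.card (normalizedFactors J) ∧
      J = P ^ Multiset.card (normalizedFactors J) := by
  classical
  obtain ⟨P, hP⟩ := Finset.card_eq_one.1 h
  have hJ0 : J ≠ 0 := by
    rintro rfl
    rw [normalizedFactors_zero, Multiset.toFinset_zero, Finset.card_empty] at h
    exact zero_ne_one h
  have hPmem : P ∈ normalizedFactors J := by
    rw [← Multiset.mem_toFinset, hP]; exact Finset.mem_singleton_self P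
  have hPprime : Prime P := prime_of_normalized_factor P hPmem
  have hrep : normalizedFactors J = Multiset.replicate (Multiset.card (normalizedFactors J)) P := by
    refine Multiset.eq_replicate.2 ⟨rfl, fun Q hQ ↦ ?_⟩
    have : Q ∈ (normalizedFactors J).toFinset := Multiset.mem_toFinset.2 hQ
    rw [hP] at this
    exact Finset.mem_singleton.1 this
  have hcard : 0 < Multiset.card (normalizedFactors J) := Multiset.card_pos_iff_exists_mem.2 ⟨P, hPmem⟩
  refine ⟨P, hPprime, hP, hrep, hcard, ?_⟩
  have hprod := prod_normalizedFactors hJ0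
  rw [associated_iff_eq] at hprod
  conv_lhs => rw [← hprod, hrep, Multiset.prod_replicate]

/-- `log N(J) = ∑_{P} v_P(J) log N(P)` over the distinct prime factors of `J ≠ 0`. [folklore] -/
theorem log_absNorm_eq_sum_count {J : Ideal R} (hJ : J ≠ ⊥) :
    Real.log (Ideal.absNorm J) =
      ∑ P ∈ (normalizedFactors J).toFinset,
        ((normalizedFactors J).count P : ℝ) * Real.log (Ideal.absNorm P) := by
  classical
  have hJ0 : J ≠ 0 := hJ
  have hprod := prod_normalizedFactors hJ0
  rw [associated_iff_eq] at hprod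
  have hJeq : J = ∏ P ∈ (normalizedFactors J).toFinset, P ^ (normalizedFactors J).count P := by
    conv_lhs => rw [← hprod]
    exact Finset.prod_multiset_count _
  conv_lhs => rw [hJeq]
  rw [map_prod, Nat.cast_prod, Real.log_prod]
  · refine Finset.sum_congr rfl fun P hP ↦ ?_
    rw [map_pow, Nat.cast_pow, Real.log_pow]
  · intro P hP
    have hPp : Prime P := prime_of_normalized_factor P (Multiset.mem_toFinset.1 hP)
    have hP0 : (Ideal.absNorm P : ℝ) ≠ 0 := by
      have : Ideal.absNorm P ≠ 0 := by rw [Ne, Ideal.absNorm_eq_zero_iff]; exact hPp.ne_zero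
      exact_mod_cast this
    simp only [map_pow, Nat.cast_pow]
    exact pow_ne_zero _ hP0

/-- **`∑_{B ∣ J} Λ(B) = log N(J)`** for `J ≠ 0` (`D` = any finset listing the divisors of `J`): the
divisors with `Λ ≠ 0` are the `P^m`, `P ∣ J`, `1 ≤ m ≤ v_P(J)`, each contributing `log N P`.
[cite: LandauMathAnn1903, §11 p. 668] -/
theorem sum_divisors_idealVonMangoldt {J : Ideal R} (hJ : J ≠ ⊥) {D : Finset (Ideal R)}
    (hD : ∀ B, B ∈ D ↔ B ∣ J) :
    ∑ B ∈ D, idealVonMangoldt B = Real.log (Ideal.absNorm J) := by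
  classical
  have hJ0 : J ≠ 0 := hJ
  set S : Finset (Ideal R) := (normalizedFactors J).toFinset with hS
  set c : Ideal R → ℕ := fun P ↦ (normalizedFactors J).count P with hc
  have hSprime : ∀ P ∈ S, Prime P := fun P hP ↦
    prime_of_normalized_factor P (Multiset.mem_toFinset.1 hP)
  have hprod := prod_normalizedFactors hJ0
  rw [associated_iff_eq] at hprod
  have hJeq : J = ∏ P ∈ S, P ^ c P := by
    conv_lhs => rw [← hprod]
    exact Finset.prod_multiset_count _
  -- RHS as a sum over `S`
  rw [log_absNorm_eq_sum_count hJ]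
  -- the sum over `(P, m)`, `P ∈ S`, `1 ≤ m ≤ c P`
  have hsigma : ∑ P ∈ S, ((normalizedFactors J).count P : ℝ) * Real.log (Ideal.absNorm P) =
      ∑ x ∈ S.sigma (fun P ↦ Finset.Icc 1 (c P)), Real.log (Ideal.absNorm x.1) := by
    rw [Finset.sum_sigma]
    refine Finset.sum_congr rfl fun P _ ↦ ?_
    dsimp only
    rw [Finset.sum_const, Nat.card_Icc, Nat.add_sub_cancel, nsmul_eq_mul]
  rw [hsigma]
  symm
  -- bijection on the non-zero terms: `(P, m) ↦ P^m`
  refine Finset.sum_bij_ne_zero (fun x _ _ ↦ x.1 ^ x.2) ?_ ?_ ?_ ?_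
  · rintro ⟨P, m⟩ hx _
    simp only [Finset.mem_sigma, Finset.mem_Icc] at hx
    obtain ⟨hP, h1, hm⟩ := hx
    rw [hD]
    calc P ^ m ∣ P ^ c P := pow_dvd_pow P hm
      _ ∣ J := by rw [hJeq]; exact Finset.dvd_prod_of_mem _ hP
  · rintro ⟨P, m⟩ hx _ ⟨P', m'⟩ hx' _ h
    simp only [Finset.mem_sigma, Finset.mem_Icc] at hx hx'
    simp only at h
    have hPp := hSprime P hx.1
    have hP'p := hSprime P' hx'.1
    have hf := congrArg normalizedFactors h
    rw [normalizedFactors_prime_pow hPp, normalizedFactors_prime_pow hP'p] at hf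
    have hm : m = m' := by simpa using congrArg Multiset.card hf
    subst hm
    have hm0 : m ≠ 0 := by omega
    have hP : P = P' := by
      have : P ∈ Multiset.replicate m P' := by rw [← hf]; exact Multiset.mem_replicate.2 ⟨hm0, rfl⟩
      exact (Multiset.mem_replicate.1 this).2
    subst hP
    rfl
  · intro B hB hΛ
    have hcard : (normalizedFactors B).toFinset.card = 1 := by
      by_contra hne; exact hΛ (idealVonMangoldt_eq_zero hne)
    obtain ⟨P, hPp, hPB, hrep, hmpos, hBeq⟩ := eq_prime_pow_of_card_eq_one hcard
    set m := Multiset.card (normalizedFactors B) with hm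
    have hBJ : B ∣ J := (hD B).1 hB
    have hB0 : B ≠ 0 := by
      rintro rfl
      rw [normalizedFactors_zero, Multiset.toFinset_zero, Finset.card_empty] at hcard
      exact zero_ne_one hcard
    have hle : normalizedFactors B ≤ normalizedFactors J :=
      (dvd_iff_normalizedFactors_le_normalizedFactors hB0 hJ0).1 hBJ
    have hcount : m ≤ c P := by
      have h1 : (normalizedFactors B).count P = m := by
        rw [hrep, Multiset.count_replicate_self]
      rw [← h1]
      exact Multiset.count_le_of_le P hle
    have hPS : P ∈ S := by
      rw [hS, Multiset.mem_toFinset, ← Multiset.count_pos]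
      have : 0 < (normalizedFactors B).count P := by
        rw [hrep, Multiset.count_replicate_self]; exact hmpos
      exact this.trans_le (Multiset.count_le_of_le P hle)
    have h2 : 1 < Ideal.absNorm P := by
      have h0 : Ideal.absNorm P ≠ 0 := by rw [Ne, Ideal.absNorm_eq_zero_iff]; exact hPp.ne_zero
      have h1 : Ideal.absNorm P ≠ 1 := by
        rw [Ne, Ideal.absNorm_eq_one_iff, ← Ideal.one_eq_top]; exact hPp.ne_one
      omega
    refine ⟨⟨P, m⟩, ?_, ?_, hBeq.symm⟩
    · simp only [Finset.mem_sigma, Finset.mem_Icc]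
      exact ⟨hPS, hmpos, hcount⟩
    · dsimp only
      exact (Real.log_pos (by exact_mod_cast h2)).ne'
  · rintro ⟨P, m⟩ hx _
    simp only [Finset.mem_sigma, Finset.mem_Icc] at hx
    dsimp only
    rw [idealVonMangoldt_prime_pow (hSprime P hx.1) (Nat.one_le_iff_ne_zero.1 hx.2.1)]

end Dedekind

/-! ## Twisted coefficients over a number field -/

namespace NumberField

open LSeries

variable (K : Type*) [Field K]

/-- The **trivial character** on the ideals of `𝓞 K`: `𝔞 ↦ 1` for `𝔞 ≠ 0`, `0 ↦ 0` (completely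
multiplicative since `𝓞 K` is a domain). [folklore] -/
def trivialChar : Ideal (𝓞 K) →*₀ ℂ where
  toFun I := if I = ⊥ then 0 else 1
  map_zero' := by simp
  map_one' := by simp
  map_mul' I J := by
    by_cases hI : I = ⊥
    · simp [hI]
    by_cases hJ : J = ⊥
    · simp [hJ]
    have : I * J ≠ ⊥ := by rw [Ne, Ideal.mul_eq_bot]; tauto
    simp [hI, hJ, this]

variable {K} in
/-- Unfolding of the trivial character. [folklore] -/
theorem trivialChar_apply (I : Ideal (𝓞 K)) : trivialChar K I = if I = ⊥ then 0 else 1 := rfl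

variable {K} in
/-- `|trivialChar 𝔞| ≤ 1`. [folklore] -/
theorem norm_trivialChar_le (I : Ideal (𝓞 K)) : ‖trivialChar K I‖ ≤ 1 := by
  rw [trivialChar_apply]; split_ifs <;> simp

variable {K} in
/-- `ν(0) = 0` for a character on ideals. [folklore] -/
theorem map_bot (ν : Ideal (𝓞 K) →*₀ ℂ) : ν ⊥ = 0 := by
  rw [← Ideal.zero_eq_bot]; exact map_zero ν

variable {K} in
/-- `ν(1) = 1` for a character on ideals. [folklore] -/
theorem map_top (ν : Ideal (𝓞 K) →*₀ ℂ) : ν ⊤ = 1 := by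
  rw [← Ideal.one_eq_top]; exact map_one ν

variable [NumberField K] (ν : Ideal (𝓞 K) →*₀ ℂ)

/-- `twistCount ν n = ∑_{N𝔞 = n} ν(𝔞)`: the `n`-th coefficient of `L(s, ν) = ∑_𝔞 ν(𝔞)N𝔞^{-s}`.
[cite: HeathBrownActa2001, §9 (9.2)] -/
def twistCount (n : ℕ) : ℂ := ∑ I ∈ idealsOfNorm K n, ν I

/-- `twistVonMangoldt ν n = ∑_{N𝔞 = n} ν(𝔞)Λ(𝔞)`: the `n`-th coefficient of `−L'/L(s, ν)`.
[cite: MontgomeryVaughan2007, §11.1 p. 277] -/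
def twistVonMangoldt (n : ℕ) : ℂ := ∑ I ∈ idealsOfNorm K n, ν I * (idealVonMangoldt I : ℂ)

/-- `twistMoebius ν n = ∑_{N𝔞 = n} μ_K(𝔞)ν(𝔞)`: the `n`-th coefficient of `1/L(s, ν)`. [folklore] -/
def twistMoebius (n : ℕ) : ℂ := ∑ I ∈ idealsOfNorm K n, (idealMoebius I : ℂ) * ν I

/-- `vonMangoldtNorm K n = ∑_{N𝔞 = n} Λ(𝔞)` (real, `≥ 0`): the `n`-th coefficient of `−ζ_K'/ζ_K`
(Landau's `L_κ(n)`; equal to `twistVonMangoldt (trivialChar K) n`). [cite: LandauMathAnn1903, §11 p. 668] -/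
def vonMangoldtNorm (n : ℕ) : ℝ := ∑ I ∈ idealsOfNorm K n, idealVonMangoldt I

variable {K ν}

/-! ### Values at `0`, `1` and majorants -/

/-- `twistCount ν 0 = 0`. [folklore] -/
theorem twistCount_zero : twistCount K ν 0 = 0 := by
  simp [twistCount, idealsOfNorm_zero, map_bot]

/-- `twistCount ν 1 = 1`. [folklore] -/
theorem twistCount_one : twistCount K ν 1 = 1 := by
  simp [twistCount, idealsOfNorm_one, map_top]

/-- `twistVonMangoldt ν 0 = 0`. [folklore] -/
theorem twistVonMangoldt_zero : twistVonMangoldt K ν 0 = 0 := by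
  simp [twistVonMangoldt, idealsOfNorm_zero, map_bot]

/-- `twistMoebius ν 0 = 0`. [folklore] -/
theorem twistMoebius_zero : twistMoebius K ν 0 = 0 := by
  simp [twistMoebius, idealsOfNorm_zero, map_bot]

/-- `twistMoebius ν 1 = 1`. [folklore] -/
theorem twistMoebius_one : twistMoebius K ν 1 = 1 := by
  simp [twistMoebius, idealsOfNorm_one, idealMoebius_top, map_top]

/-- `Λ_K(n) ≥ 0`. [folklore] -/
theorem vonMangoldtNorm_nonneg (n : ℕ) : 0 ≤ vonMangoldtNorm K n :=
  Finset.sum_nonneg fun I _ ↦ idealVonMangoldt_nonneg I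

/-- `twistVonMangoldt (trivialChar K) = vonMangoldtNorm K` (as complex numbers). [folklore] -/
theorem twistVonMangoldt_trivialChar (n : ℕ) :
    twistVonMangoldt K (trivialChar K) n = (vonMangoldtNorm K n : ℂ) := by
  unfold twistVonMangoldt vonMangoldtNorm
  push_cast
  refine Finset.sum_congr rfl fun I hI ↦ ?_
  rw [trivialChar_apply]
  split_ifs with h
  · subst h
    simp [idealVonMangoldt_bot]
  · rw [one_mul]

/-- `twistCount (trivialChar K) n = #{𝔞 : N𝔞 = n}` for `n ≠ 0`. [folklore] -/
theorem twistCount_trivialChar {n : ℕ} (hn : n ≠ 0) :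
    twistCount K (trivialChar K) n = (idealNormCount K n : ℂ) := by
  unfold twistCount
  rw [← card_idealsOfNorm, Finset.card_eq_sum_ones, Nat.cast_sum]
  refine Finset.sum_congr rfl fun I hI ↦ ?_
  rw [trivialChar_apply, if_neg, Nat.cast_one]
  intro h
  rw [mem_idealsOfNorm, h, Ideal.absNorm_bot] at hI
  exact hn hI.symm

/-- `‖twistCount ν n‖ ≤ #{𝔞 : N𝔞 = n}` when `|ν| ≤ 1`. [folklore] -/
theorem norm_twistCount_le (hν : ∀ I, ‖ν I‖ ≤ 1) (n : ℕ) :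
    ‖twistCount K ν n‖ ≤ idealNormCount K n := by
  unfold twistCount
  rw [← card_idealsOfNorm]
  calc ‖∑ I ∈ idealsOfNorm K n, ν I‖ ≤ ∑ I ∈ idealsOfNorm K n, ‖ν I‖ := norm_sum_le _ _
    _ ≤ ∑ I ∈ idealsOfNorm K n, (1 : ℝ) := Finset.sum_le_sum fun I _ ↦ hν I
    _ = (idealsOfNorm K n).card := by simp

/-- `‖twistMoebius ν n‖ ≤ #{𝔞 : N𝔞 = n}` when `|ν| ≤ 1`. [folklore] -/
theorem norm_twistMoebius_le (hν : ∀ I, ‖ν I‖ ≤ 1) (n : ℕ) :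
    ‖twistMoebius K ν n‖ ≤ idealNormCount K n := by
  unfold twistMoebius
  rw [← card_idealsOfNorm]
  calc ‖∑ I ∈ idealsOfNorm K n, (idealMoebius I : ℂ) * ν I‖
      ≤ ∑ I ∈ idealsOfNorm K n, ‖(idealMoebius I : ℂ) * ν I‖ := norm_sum_le _ _
    _ ≤ ∑ I ∈ idealsOfNorm K n, (1 : ℝ) := Finset.sum_le_sum fun I _ ↦ by
        rw [norm_mul]
        have h1 : ‖(idealMoebius I : ℂ)‖ ≤ 1 := by
          rw [Complex.norm_intCast]; exact_mod_cast abs_idealMoebius_le_one I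
        exact mul_le_one₀ h1 (norm_nonneg _) (hν I)
    _ = (idealsOfNorm K n).card := by simp

/-- `‖twistVonMangoldt ν n‖ ≤ vonMangoldtNorm K n` when `|ν| ≤ 1`. [folklore] -/
theorem norm_twistVonMangoldt_le (hν : ∀ I, ‖ν I‖ ≤ 1) (n : ℕ) :
    ‖twistVonMangoldt K ν n‖ ≤ vonMangoldtNorm K n := by
  unfold twistVonMangoldt vonMangoldtNorm
  calc ‖∑ I ∈ idealsOfNorm K n, ν I * (idealVonMangoldt I : ℂ)‖
      ≤ ∑ I ∈ idealsOfNorm K n, ‖ν I * (idealVonMangoldt I : ℂ)‖ := norm_sum_le _ _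
    _ ≤ ∑ I ∈ idealsOfNorm K n, idealVonMangoldt I := Finset.sum_le_sum fun I _ ↦ by
        rw [norm_mul, Complex.norm_real, Real.norm_of_nonneg (idealVonMangoldt_nonneg I)]
        exact mul_le_of_le_one_left (idealVonMangoldt_nonneg I) (hν I)

/-- `Λ(𝔞) ≤ log N𝔞` for `𝔞 ≠ 0`. [folklore] -/
theorem idealVonMangoldt_le_log {I : Ideal (𝓞 K)} (hI : I ≠ ⊥) :
    idealVonMangoldt I ≤ Real.log (Ideal.absNorm I) := by
  classical
  rw [← sum_divisors_idealVonMangoldt hI (fun B ↦ mem_filter_dvd_iff hI)]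
  refine Finset.single_le_sum (fun B _ ↦ idealVonMangoldt_nonneg B) ?_
  exact (mem_filter_dvd_iff hI).2 dvd_rfl

/-- `vonMangoldtNorm K n ≤ #{𝔞 : N𝔞 = n} · log n`. [folklore] -/
theorem vonMangoldtNorm_le (n : ℕ) :
    vonMangoldtNorm K n ≤ idealNormCount K n * Real.log n := by
  rcases eq_or_ne n 0 with rfl | hn
  · simp [vonMangoldtNorm, idealsOfNorm_zero, idealVonMangoldt_bot]
  unfold vonMangoldtNorm
  rw [← card_idealsOfNorm]
  calc ∑ I ∈ idealsOfNorm K n, idealVonMangoldt I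
      ≤ ∑ I ∈ idealsOfNorm K n, Real.log n := Finset.sum_le_sum fun I hI ↦ by
        rw [mem_idealsOfNorm] at hI
        have hI0 : I ≠ ⊥ := by rintro rfl; rw [Ideal.absNorm_bot] at hI; exact hn hI.symm
        have := idealVonMangoldt_le_log hI0
        rwa [hI] at this
    _ = (idealsOfNorm K n).card * Real.log n := by rw [Finset.sum_const, nsmul_eq_mul]

/-! ### Regrouping pairs of ideals by their product -/

open scoped Classical in
/-- Regrouping the pairs `(B, A)` with `N(B)N(A) = n` as the pairs `(J, B)` with `N(J) = n`,
`B ∣ J` (`J = BA`; cancellation of nonzero ideals), for a summand with values in any additive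
commutative monoid: `∑_{ab=n} ∑_{N(B)=a} ∑_{N(A)=b} φ(BA, B) = ∑_{N(J)=n} ∑_{B ∣ J} φ(J, B)` (`n ≠ 0`).
(`IdealMoebiusCoprime.sum_divisorsAntidiagonal_regroup` is the `ℤ`-valued case.) [folklore] -/
theorem sum_divisorsAntidiagonal_regroup' {M : Type*} [AddCommMonoid M]
    (φ : Ideal (𝓞 K) → Ideal (𝓞 K) → M) {n : ℕ} (hn : n ≠ 0) :
    ∑ p ∈ n.divisorsAntidiagonal, ∑ B ∈ idealsOfNorm K p.1, ∑ A ∈ idealsOfNorm K p.2, φ (B * A) B =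
      ∑ J ∈ idealsOfNorm K n,
        ∑ B ∈ ((Finset.Icc 1 (Ideal.absNorm J)).biUnion (idealsOfNorm K)).filter (· ∣ J),
          φ J B := by
  have hL : ∑ p ∈ n.divisorsAntidiagonal, ∑ B ∈ idealsOfNorm K p.1, ∑ A ∈ idealsOfNorm K p.2,
      φ (B * A) B =
      ∑ x ∈ n.divisorsAntidiagonal.sigma (fun p ↦ idealsOfNorm K p.1 ×ˢ idealsOfNorm K p.2),
        φ (x.2.1 * x.2.2) x.2.1 := by
    rw [Finset.sum_sigma]
    refine Finset.sum_congr rfl fun p _ ↦ ?_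
    rw [Finset.sum_product]
  set Dv : Ideal (𝓞 K) → Finset (Ideal (𝓞 K)) := fun J ↦
    ((Finset.Icc 1 (Ideal.absNorm J)).biUnion (idealsOfNorm K)).filter (· ∣ J) with hDv
  have hR : ∑ J ∈ idealsOfNorm K n, ∑ B ∈ Dv J, φ J B =
      ∑ y ∈ (idealsOfNorm K n).sigma Dv, φ y.1 y.2 := by
    rw [Finset.sum_sigma]
  rw [hL, hR]
  refine Finset.sum_bij (fun x _ ↦ ⟨x.2.1 * x.2.2, x.2.1⟩) ?_ ?_ ?_ ?_
  · rintro ⟨⟨a, b⟩, ⟨B, A⟩⟩ hx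
    simp only [Finset.mem_sigma, Nat.mem_divisorsAntidiagonal, Finset.mem_product,
      mem_idealsOfNorm] at hx
    obtain ⟨⟨hab, -⟩, hB, hA⟩ := hx
    have hJn : Ideal.absNorm (B * A) = n := by rw [map_mul, hB, hA, hab]
    have hJ0 : B * A ≠ ⊥ := by rw [Ne, ← Ideal.absNorm_eq_zero_iff, hJn]; exact hn
    simp only [Finset.mem_sigma, mem_idealsOfNorm, hJn, true_and, hDv]
    have := (mem_filter_dvd_iff hJ0).2 (dvd_mul_right B A)
    rwa [hJn] at this
  · rintro ⟨⟨a, b⟩, ⟨B, A⟩⟩ hx ⟨⟨a', b'⟩, ⟨B', A'⟩⟩ hx' h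
    simp only [Finset.mem_sigma, Nat.mem_divisorsAntidiagonal, Finset.mem_product,
      mem_idealsOfNorm] at hx hx'
    simp only [Sigma.mk.injEq, heq_eq_eq] at h
    obtain ⟨hJ, rfl⟩ := h
    have hB0 : B ≠ 0 := by
      intro h0
      rw [h0, Ideal.zero_eq_bot, Ideal.absNorm_bot] at hx
      obtain ⟨⟨hab, -⟩, hB, -⟩ := hx
      exact hn (by rw [← hab, ← hB]; simp)
    have hA : A = A' := mul_left_cancel₀ hB0 hJ
    subst hA
    obtain ⟨⟨-, -⟩, hB, hA⟩ := hx
    obtain ⟨⟨-, -⟩, hB', hA'⟩ := hx'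
    simp [← hB, ← hB', ← hA, ← hA']
  · rintro ⟨J, B⟩ hy
    simp only [Finset.mem_sigma, mem_idealsOfNorm, hDv] at hy
    obtain ⟨hJn, hBmem⟩ := hy
    have hJ0 : J ≠ ⊥ := by rw [Ne, ← Ideal.absNorm_eq_zero_iff, hJn]; exact hn
    obtain ⟨A, rfl⟩ := (mem_filter_dvd_iff hJ0).1 hBmem
    refine ⟨⟨⟨Ideal.absNorm B, Ideal.absNorm A⟩, ⟨B, A⟩⟩, ?_, rfl⟩
    simp only [Finset.mem_sigma, Nat.mem_divisorsAntidiagonal, Finset.mem_product, mem_idealsOfNorm,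
      and_true, and_self]
    exact ⟨by rw [← map_mul, hJn], hn⟩
  · intro x _
    rfl

/-! ### The convolution identities -/

/-- **`(νΛ) ⋆ ν = ν · log`**: for `n ≠ 0`,
`∑_{ab = n} twistVonMangoldt ν a · twistCount ν b = twistCount ν n · log n`
(regroup with `φ(J, B) = Λ(B)ν(J)`, complete multiplicativity `ν(B)ν(A) = ν(BA)`, and
`∑_{B ∣ J} Λ(B) = log N J = log n`). [cite: MontgomeryVaughan2007, §11.1 p. 277] -/
theorem sum_divisorsAntidiagonal_twistVonMangoldt_mul_twistCount {n : ℕ} (hn : n ≠ 0) :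
    ∑ p ∈ n.divisorsAntidiagonal, twistVonMangoldt K ν p.1 * twistCount K ν p.2 =
      twistCount K ν n * (Real.log n : ℂ) := by
  classical
  set φ : Ideal (𝓞 K) → Ideal (𝓞 K) → ℂ := fun J B ↦ (idealVonMangoldt B : ℂ) * ν J with hφ
  have h1 : ∑ p ∈ n.divisorsAntidiagonal, twistVonMangoldt K ν p.1 * twistCount K ν p.2 =
      ∑ p ∈ n.divisorsAntidiagonal, ∑ B ∈ idealsOfNorm K p.1, ∑ A ∈ idealsOfNorm K p.2,
        φ (B * A) B := by
    refine Finset.sum_congr rfl fun p _ ↦ ?_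
    unfold twistVonMangoldt twistCount
    rw [Finset.sum_mul]
    refine Finset.sum_congr rfl fun B _ ↦ ?_
    rw [Finset.mul_sum]
    refine Finset.sum_congr rfl fun A _ ↦ ?_
    simp only [hφ, map_mul]; ring
  rw [h1, sum_divisorsAntidiagonal_regroup' φ hn]
  simp only [hφ]
  unfold twistCount
  rw [Finset.sum_mul]
  refine Finset.sum_congr rfl fun J hJ ↦ ?_
  rw [mem_idealsOfNorm] at hJ
  have hJ0 : J ≠ ⊥ := by rw [Ne, ← Ideal.absNorm_eq_zero_iff, hJ]; exact hn
  rw [← Finset.sum_mul, ← Complex.ofReal_sum (f := idealVonMangoldt),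
    sum_divisors_idealVonMangoldt hJ0 (fun B ↦ mem_filter_dvd_iff hJ0), hJ, mul_comm]

/-- **`(μ_K ν) ⋆ ν = δ`**: for `n ≠ 0`,
`∑_{ab = n} twistMoebius ν a · twistCount ν b = [n = 1]` (regroup with `φ(J, B) = μ(B)ν(J)` and
`∑_{B ∣ J} μ(B) = [J = (1)]`). [folklore] -/
theorem sum_divisorsAntidiagonal_twistMoebius_mul_twistCount {n : ℕ} (hn : n ≠ 0) :
    ∑ p ∈ n.divisorsAntidiagonal, twistMoebius K ν p.1 * twistCount K ν p.2 =
      if n = 1 then 1 else 0 := by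
  classical
  set φ : Ideal (𝓞 K) → Ideal (𝓞 K) → ℂ := fun J B ↦ (idealMoebius B : ℂ) * ν J with hφ
  have h1 : ∑ p ∈ n.divisorsAntidiagonal, twistMoebius K ν p.1 * twistCount K ν p.2 =
      ∑ p ∈ n.divisorsAntidiagonal, ∑ B ∈ idealsOfNorm K p.1, ∑ A ∈ idealsOfNorm K p.2,
        φ (B * A) B := by
    refine Finset.sum_congr rfl fun p _ ↦ ?_
    unfold twistMoebius twistCount
    rw [Finset.sum_mul]
    refine Finset.sum_congr rfl fun B _ ↦ ?_
    rw [Finset.mul_sum]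
    refine Finset.sum_congr rfl fun A _ ↦ ?_
    simp only [hφ, map_mul]; ring
  rw [h1, sum_divisorsAntidiagonal_regroup' φ hn]
  simp only [hφ]
  have h2 : ∀ J ∈ idealsOfNorm K n,
      ∑ B ∈ ((Finset.Icc 1 (Ideal.absNorm J)).biUnion (idealsOfNorm K)).filter (· ∣ J),
        (idealMoebius B : ℂ) * ν J = if J = ⊤ then ν J else 0 := by
    intro J hJ
    rw [mem_idealsOfNorm] at hJ
    have hJ0 : J ≠ ⊥ := by rw [Ne, ← Ideal.absNorm_eq_zero_iff, hJ]; exact hn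
    rw [← Finset.sum_mul, ← Int.cast_sum, sum_idealMoebius_of_dvd hJ0 (fun B ↦ mem_filter_dvd_iff hJ0)]
    split_ifs <;> simp
  rw [Finset.sum_congr rfl h2]
  by_cases hn1 : n = 1
  · subst hn1
    rw [idealsOfNorm_one, Finset.sum_singleton, if_pos rfl, if_pos rfl, map_top]
  · rw [if_neg hn1]
    refine Finset.sum_eq_zero fun J hJ ↦ ?_
    rw [mem_idealsOfNorm] at hJ
    rw [if_neg]
    rintro rfl
    rw [Ideal.absNorm_top] at hJ
    exact hn1 hJ.symm

/-- The convolution identities as equalities of arithmetic functions: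
`twistVonMangoldt ν ⍟ twistCount ν = logMul (twistCount ν)`. [folklore] -/
theorem convolution_twistVonMangoldt_twistCount :
    twistVonMangoldt K ν ⍟ twistCount K ν = LSeries.logMul (twistCount K ν) := by
  rw [LSeries.convolution_def]
  funext n
  rcases eq_or_ne n 0 with rfl | hn
  · simp [LSeries.logMul]
  rw [sum_divisorsAntidiagonal_twistVonMangoldt_mul_twistCount hn, LSeries.logMul,
    Complex.natCast_log, mul_comm]

/-- `twistMoebius ν ⍟ twistCount ν = δ`. [folklore] -/
theorem convolution_twistMoebius_twistCount :
    twistMoebius K ν ⍟ twistCount K ν = δ := by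
  rw [LSeries.convolution_def]
  funext n
  rcases eq_or_ne n 0 with rfl | hn
  · simp [LSeries.delta]
  rw [sum_divisorsAntidiagonal_twistMoebius_mul_twistCount hn, LSeries.delta]

/-! ### The `L`-series on `σ > 1` -/

section LSeriesFacts

variable (hν : ∀ I, ‖ν I‖ ≤ 1)
include hν

/-- `L(twistCount ν, ·)` converges absolutely for `σ > 1`. [folklore] -/
theorem LSeriesSummable_twistCount {s : ℂ} (hs : 1 < s.re) : LSeriesSummable (twistCount K ν) s := by
  refine Summable.of_norm_bounded (LSeriesSummable_idealNormCount K hs).norm fun n ↦ ?_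
  refine LSeries.norm_term_le s ?_
  rw [Complex.norm_natCast]
  exact norm_twistCount_le hν n

/-- `L(twistMoebius ν, ·)` converges absolutely for `σ > 1`. [folklore] -/
theorem LSeriesSummable_twistMoebius {s : ℂ} (hs : 1 < s.re) :
    LSeriesSummable (twistMoebius K ν) s := by
  refine Summable.of_norm_bounded (LSeriesSummable_idealNormCount K hs).norm fun n ↦ ?_
  refine LSeries.norm_term_le s ?_
  rw [Complex.norm_natCast]
  exact norm_twistMoebius_le hν n

omit hν in
/-- `L(vonMangoldtNorm K, ·)` converges absolutely for `σ > 1` (`Λ_K(n) ≤ c_K(n) log n`). [folklore] -/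
theorem LSeriesSummable_vonMangoldtNorm {s : ℂ} (hs : 1 < s.re) :
    LSeriesSummable (fun n ↦ (vonMangoldtNorm K n : ℂ)) s := by
  have h := LSeriesSummable_logMul_of_lt_re
    ((abscissaOfAbsConv_idealNormCount_le K).trans_lt (by exact_mod_cast hs) :
      LSeries.abscissaOfAbsConv (fun n ↦ (idealNormCount K n : ℂ)) < s.re)
  refine Summable.of_norm_bounded h.norm fun n ↦ LSeries.norm_term_le s ?_
  rw [Complex.norm_real, Real.norm_of_nonneg (vonMangoldtNorm_nonneg n), LSeries.logMul, norm_mul,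
    ← Complex.natCast_log, Complex.norm_real, Real.norm_of_nonneg (Real.log_natCast_nonneg n),
    Complex.norm_natCast, mul_comm]
  exact vonMangoldtNorm_le n

/-- `L(twistVonMangoldt ν, ·)` converges absolutely for `σ > 1`. [folklore] -/
theorem LSeriesSummable_twistVonMangoldt {s : ℂ} (hs : 1 < s.re) :
    LSeriesSummable (twistVonMangoldt K ν) s := by
  refine Summable.of_norm_bounded (LSeriesSummable_vonMangoldtNorm (K := K) hs).norm fun n ↦ ?_
  refine LSeries.norm_term_le s ?_
  rw [Complex.norm_real, Real.norm_of_nonneg (vonMangoldtNorm_nonneg n)]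
  exact norm_twistVonMangoldt_le hν n

/-- The abscissa of absolute convergence of `twistCount ν` is `≤ 1`. [folklore] -/
theorem abscissaOfAbsConv_twistCount_le : LSeries.abscissaOfAbsConv (twistCount K ν) ≤ 1 :=
  LSeries.abscissaOfAbsConv_le_of_forall_lt_LSeriesSummable fun y hy ↦
    LSeriesSummable_twistCount hν (by exact_mod_cast hy)

/-- **`L(μ_K ν, s) · L(ν, s) = 1`** for `σ > 1`. [folklore] -/
theorem LSeries_twistMoebius_mul_twistCount {s : ℂ} (hs : 1 < s.re) :
    LSeries (twistMoebius K ν) s * LSeries (twistCount K ν) s = 1 := by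
  rw [← LSeries_convolution' (LSeriesSummable_twistMoebius hν hs) (LSeriesSummable_twistCount hν hs),
    convolution_twistMoebius_twistCount]
  exact congr_fun LSeries_delta s

/-- **`L(ν, s) ≠ 0`** for `σ > 1`. [folklore] -/
theorem LSeries_twistCount_ne_zero {s : ℂ} (hs : 1 < s.re) : LSeries (twistCount K ν) s ≠ 0 := by
  intro h
  have := LSeries_twistMoebius_mul_twistCount hν hs
  rw [h, mul_zero] at this
  exact zero_ne_one this

/-- **`L(ν)' = −L(νΛ)·L(ν)`** on `σ > 1` (`logMul (twistCount ν) = twistVonMangoldt ν ⋆ twistCount ν`).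
[cite: MontgomeryVaughan2007, §11.1 p. 277] -/
theorem deriv_LSeries_twistCount {s : ℂ} (hs : 1 < s.re) :
    deriv (LSeries (twistCount K ν)) s =
      -(LSeries (twistVonMangoldt K ν) s * LSeries (twistCount K ν) s) := by
  rw [LSeries_deriv ((abscissaOfAbsConv_twistCount_le hν).trans_lt (by exact_mod_cast hs)),
    ← convolution_twistVonMangoldt_twistCount,
    LSeries_convolution' (LSeriesSummable_twistVonMangoldt hν hs) (LSeriesSummable_twistCount hν hs)]

/-- **`L'/L(s, ν) = −L(νΛ, s)`** for `σ > 1`. [cite: MontgomeryVaughan2007, §11.1 p. 277] -/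
theorem logDeriv_LSeries_twistCount {s : ℂ} (hs : 1 < s.re) :
    deriv (LSeries (twistCount K ν)) s / LSeries (twistCount K ν) s =
      -LSeries (twistVonMangoldt K ν) s := by
  rw [deriv_LSeries_twistCount hν hs, neg_div, mul_div_cancel_right₀ _ (LSeries_twistCount_ne_zero hν hs)]

end LSeriesFacts

/-- **`L(twistCount (trivialChar K), ·) = ζ_K`** (as Dirichlet series, i.e. as functions on `ℂ`;
the coefficients agree for `n ≥ 1`). [folklore] -/
theorem LSeries_twistCount_trivialChar :
    LSeries (twistCount K (trivialChar K)) = _root_.NumberField.dedekindZeta K := by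
  funext s
  rw [dedekindZeta_eq_LSeries]
  exact LSeries_congr (fun hn ↦ twistCount_trivialChar hn) s

/-- **`L(vonMangoldtNorm K, s) = −ζ_K'/ζ_K(s) = L(Λ_K, s)`** for `σ > 1`: our `Λ_K(n) = ∑_{N𝔞=n}Λ(𝔞)`
and the tree's `vonMangoldtIdeal K n` have the same `L`-series. [cite: LandauMathAnn1903, §11 p. 668] -/
theorem LSeries_vonMangoldtNorm_eq {s : ℂ} (hs : 1 < s.re) :
    LSeries (fun n ↦ (vonMangoldtNorm K n : ℂ)) s = LSeries (fun n ↦ (vonMangoldtIdeal K n : ℂ)) s := by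
  have hν : ∀ I, ‖trivialChar K I‖ ≤ 1 := norm_trivialChar_le
  -- `L(vonMangoldtNorm) = L(twistVonMangoldt triv) = -ζ_K'/ζ_K`
  have h1 : LSeries (fun n ↦ (vonMangoldtNorm K n : ℂ)) s =
      LSeries (twistVonMangoldt K (trivialChar K)) s :=
    LSeries_congr (fun _ ↦ (twistVonMangoldt_trivialChar _).symm) s
  have h2 := logDeriv_LSeries_twistCount hν hs
  rw [LSeries_twistCount_trivialChar] at h2
  rw [h1, ← neg_logDeriv_dedekindZeta_eq K hs, h2, neg_neg]

/-- **`Re L(Λ_K, σ) ≤ 1/(σ − 1) + K₀`** for `1 < σ ≤ 2` (the pole of `ζ_K`; from the tree's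
`ClassicalZFRData` for Landau's continuation of `ζ_K`). [cite: MontgomeryVaughan2007, §8.4 p. 267] -/
theorem exists_re_LSeries_vonMangoldtNorm_le :
    ∃ K₀ : ℝ, 0 ≤ K₀ ∧ ∀ σ : ℝ, 1 < σ → σ ≤ 2 →
      (LSeries (fun n ↦ (vonMangoldtNorm K n : ℂ)) σ).re ≤ 1 / (σ - 1) + K₀ := by
  obtain ⟨G, hG, hG1, hgrowth⟩ := exists_isLandauContinuation_holds K
  have hZ := classicalZFRData_of_isLandauContinuation hG hG1 hgrowth
  obtain ⟨K₁, hK₁, hK⟩ := hZ.exists_bound_LSeries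
  refine ⟨K₁, hK₁, fun σ hσ hσ2 ↦ ?_⟩
  have h := (hK σ (by simp [hσ]) (by simp [hσ2])).1
  simp only [Complex.ofReal_re] at h
  rwa [LSeries_vonMangoldtNorm_eq (K := K) (by simp [hσ])]

/-- **Lower bound `c_K (σ − 1) ≤ |L(s, ν)|`** for `1 < σ ≤ 2`, with `c_K > 0` depending on `K` only
(not on `ν`): `1 = |L(μ_Kν, s) L(ν, s)| ≤ ζ_K(σ)|L(ν, s)|` and `(σ − 1)ζ_K(σ) ≤ B_K` (Landau's
continuation `G(σ) = (σ−1)ζ_K(σ)` is bounded on `[1, 2]`). [cite: MontgomeryVaughan2007, Lemma 11.1 (proof)] -/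
theorem exists_norm_LSeries_twistCount_ge :
    ∃ c₁ : ℝ, 0 < c₁ ∧ ∀ ν : Ideal (𝓞 K) →*₀ ℂ, (∀ I, ‖ν I‖ ≤ 1) → ∀ s : ℂ, 1 < s.re → s.re ≤ 2 →
      c₁ * (s.re - 1) ≤ ‖LSeries (twistCount K ν) s‖ := by
  obtain ⟨G, hG, hG1, hgrowth⟩ := exists_isLandauContinuation_holds K
  have hZ := classicalZFRData_of_isLandauContinuation hG hG1 hgrowth
  obtain ⟨A, C, hA, hgr⟩ := hZ.growth
  -- `B = C 4^A` bounds `(σ - 1) ζ_K(σ)` on `(1, 2]`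
  set B : ℝ := C * (4 : ℝ) ^ A with hB
  have hη := hZ.eta_pos
  have hB0 : 0 ≤ B := by
    have := hgr 2 (by rw [Complex.re_ofNat]; linarith) (by rw [Complex.re_ofNat]; norm_num)
    simp only [Complex.im_ofNat, abs_zero, zero_add] at this
    exact (norm_nonneg _).trans this
  have hζB : ∀ σ : ℝ, 1 < σ → σ ≤ 2 →
      (σ - 1) * (LSeries (fun n ↦ (idealNormCount K n : ℂ)) σ).re ≤ B := by
    intro σ h1 h2
    have hGσ : G σ = ((σ : ℂ) - 1) * _root_.NumberField.dedekindZeta K σ := hG.eq_mul σ (by simp [h1])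
    have hgrσ := hgr σ (by rw [Complex.ofReal_re]; linarith) (by rw [Complex.ofReal_re]; linarith)
    simp only [Complex.ofReal_im, abs_zero, zero_add] at hgrσ
    rw [hGσ, norm_mul, show ((σ : ℂ) - 1) = ((σ - 1 : ℝ) : ℂ) by push_cast; ring,
      Complex.norm_real, Real.norm_of_nonneg (by linarith), dedekindZeta_eq_LSeries] at hgrσ
    refine le_trans ?_ (hgrσ.trans (le_of_eq (by rw [hB])))
    gcongr
    exact Complex.re_le_norm _
  refine ⟨1 / (B + 1), by positivity, fun ν hν s hs hs2 ↦ ?_⟩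
  set σ : ℝ := s.re with hσ
  set Λ₀ : ℕ → ℝ := fun n ↦ (idealNormCount K n : ℝ) with hΛ₀
  set g : ℕ → ℂ := fun n ↦ (Λ₀ n : ℂ) with hg
  have hgg : g = fun n ↦ (idealNormCount K n : ℂ) := funext fun n ↦ by simp [hg, hΛ₀]
  -- majorant: `‖L(μν, s)‖ ≤ Re ζ_K(σ)`
  have hmaj : ‖LSeries (twistMoebius K ν) s‖ ≤ (LSeries g (σ : ℂ)).re := by
    have hsumσ : LSeriesSummable g (σ : ℂ) := by
      rw [hgg]; exact LSeriesSummable_idealNormCount K (by simp only [Complex.ofReal_re]; exact hs)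
    have h2 : ∀ n, ‖LSeries.term g (σ : ℂ) n‖ = (LSeries.term g (σ : ℂ) n).re := by
      intro n
      rcases eq_or_ne n 0 with rfl | hn
      · simp
      rw [LSeries.norm_term_eq, if_neg hn, LSeries.term_of_ne_zero hn, Complex.norm_real,
        Real.norm_of_nonneg (Nat.cast_nonneg _)]
      have : (n : ℂ) ^ (σ : ℂ) = ((n : ℝ) ^ σ : ℝ) := by
        rw [Complex.ofReal_cpow (Nat.cast_nonneg n)]; simp
      rw [this, ← Complex.ofReal_div, Complex.ofReal_re, Complex.ofReal_re]
    have h3 : (LSeries g (σ : ℂ)).re = ∑' n, (LSeries.term g (σ : ℂ) n).re := by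
      rw [LSeries, Complex.re_tsum hsumσ]
    have h4 : ∀ n, ‖LSeries.term (twistMoebius K ν) s n‖ ≤ ‖LSeries.term g (σ : ℂ) n‖ := by
      intro n
      rcases eq_or_ne n 0 with rfl | hn
      · simp
      have h5 : ‖LSeries.term (twistMoebius K ν) s n‖ ≤ ‖LSeries.term g s n‖ := by
        refine LSeries.norm_term_le s ?_
        rw [Complex.norm_real, Real.norm_of_nonneg (Nat.cast_nonneg _)]
        exact norm_twistMoebius_le hν n
      exact h5.trans (LSeries.norm_term_le_of_re_le_re g (by simp [hσ]) n)
    have hfs : Summable fun n ↦ ‖LSeries.term (twistMoebius K ν) s n‖ :=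
      Summable.of_nonneg_of_le (fun n ↦ norm_nonneg _) h4 hsumσ.norm
    calc ‖LSeries (twistMoebius K ν) s‖ ≤ ∑' n, ‖LSeries.term (twistMoebius K ν) s n‖ :=
          norm_tsum_le_tsum_norm hfs
      _ ≤ ∑' n, ‖LSeries.term g (σ : ℂ) n‖ := Summable.tsum_le_tsum h4 hfs hsumσ.norm
      _ = ∑' n, (LSeries.term g (σ : ℂ) n).re := tsum_congr h2
      _ = (LSeries g (σ : ℂ)).re := h3.symm
  -- `1 ≤ Re ζ_K(σ) · ‖L(ν, s)‖`
  have h1 : 1 ≤ (LSeries g (σ : ℂ)).re * ‖LSeries (twistCount K ν) s‖ := by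
    have := LSeries_twistMoebius_mul_twistCount hν hs
    have hn : (1 : ℝ) = ‖LSeries (twistMoebius K ν) s‖ * ‖LSeries (twistCount K ν) s‖ := by
      rw [← norm_mul, this, norm_one]
    rw [hn]
    exact mul_le_mul_of_nonneg_right hmaj (norm_nonneg _)
  have hσ1 : 0 < σ - 1 := by linarith
  have h2 := hζB σ hs hs2
  rw [← hgg] at h2
  have h3 : (σ - 1) ≤ B * ‖LSeries (twistCount K ν) s‖ := by
    calc σ - 1 = (σ - 1) * 1 := (mul_one _).symm
      _ ≤ (σ - 1) * ((LSeries g (σ : ℂ)).re * ‖LSeries (twistCount K ν) s‖) :=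
          mul_le_mul_of_nonneg_left h1 hσ1.le
      _ = (σ - 1) * (LSeries g (σ : ℂ)).re * ‖LSeries (twistCount K ν) s‖ := by ring
      _ ≤ B * ‖LSeries (twistCount K ν) s‖ := mul_le_mul_of_nonneg_right h2 (norm_nonneg _)
  rw [div_mul_eq_mul_div, one_mul, div_le_iff₀ (by positivity)]
  nlinarith [norm_nonneg (LSeries (twistCount K ν) s)]

/-! ### The `3-4-1` positivity (MV Lemma 11.2 over `K`) -/

/-- The terms of a Dirichlet series at `s = σ + it`: `f(n) n^{-s} = n^{-σ} · (f(n) n^{-it})` (`n ≥ 1`).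
[folklore] -/
theorem term_eq_inv_rpow_mul (f : ℕ → ℂ) (σ t : ℝ) {n : ℕ} (hn : n ≠ 0) :
    LSeries.term f (σ + t * I) n = ((((n : ℝ) ^ σ)⁻¹ : ℝ) : ℂ) * (f n * (n : ℂ) ^ (-(t * I))) := by
  have hn0 : (n : ℂ) ≠ 0 := Nat.cast_ne_zero.2 hn
  rw [LSeries.term_of_ne_zero hn, Complex.cpow_add _ _ hn0, Complex.cpow_neg,
    Complex.ofReal_inv, Complex.ofReal_cpow (Nat.cast_nonneg n)]
  have h1 : ((n : ℝ) : ℂ) ^ (σ : ℂ) ≠ 0 := by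
    rw [Ne, Complex.cpow_eq_zero_iff]; push_cast; exact fun h ↦ hn0 h.1
  have h2 : (n : ℂ) ^ ((t : ℂ) * I) ≠ 0 := by
    rw [Ne, Complex.cpow_eq_zero_iff]; exact fun h ↦ hn0 h.1
  push_cast
  field_simp

/-- The `n`-th terms of `3L(Λ_K, σ) + 4L(νΛ, σ+it) + L(ν²Λ, σ+2it)` have non-negative real part:
they equal `n^{-σ} ∑_{N𝔞 = n} Λ(𝔞)(3 + 4w_𝔞 + w_𝔞²)`, `w_𝔞 = ν(𝔞)n^{-it}`, `|w_𝔞| ≤ 1`, and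
`3 + 4 Re w + Re w² = 2(1 + Re w)² + (1 − |w|²) ≥ 0`. [cite: MontgomeryVaughan2007, Lemma 11.2] -/
theorem re_three_four_one_terms_nonneg (hν : ∀ I, ‖ν I‖ ≤ 1) {ν₂ : Ideal (𝓞 K) →*₀ ℂ}
    (hν₂ : ∀ I, ν₂ I = ν I ^ 2) (σ t : ℝ) (n : ℕ) :
    0 ≤ 3 * (LSeries.term (fun n ↦ (vonMangoldtNorm K n : ℂ)) σ n).re +
      4 * (LSeries.term (twistVonMangoldt K ν) (σ + t * I) n).re +
        (LSeries.term (twistVonMangoldt K ν₂) (σ + 2 * t * I) n).re := by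
  rcases eq_or_ne n 0 with rfl | hn
  · simp
  have hn0 : (n : ℂ) ≠ 0 := Nat.cast_ne_zero.2 hn
  set r : ℝ := ((n : ℝ) ^ σ)⁻¹ with hr
  have hr0 : 0 ≤ r := by positivity
  set e : ℂ := (n : ℂ) ^ (-(t * I)) with he
  have he1 : ‖e‖ = 1 := by
    rw [he, Complex.norm_natCast_cpow_of_pos (Nat.pos_of_ne_zero hn)]
    simp
  have he2 : (n : ℂ) ^ (-((2 * t : ℝ) * I)) = e ^ 2 := by
    rw [he, sq, ← Complex.cpow_add _ _ hn0]
    congr 1; push_cast; ring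
  -- the three terms through `r` and `e`
  have hA : LSeries.term (fun n ↦ (vonMangoldtNorm K n : ℂ)) σ n = ((r * vonMangoldtNorm K n : ℝ) : ℂ) := by
    have := term_eq_inv_rpow_mul (fun n ↦ (vonMangoldtNorm K n : ℂ)) σ 0 hn
    simp only [Complex.ofReal_zero, zero_mul, add_zero, neg_zero, Complex.cpow_zero, mul_one] at this
    rw [this, hr]; push_cast; ring
  have hB : LSeries.term (twistVonMangoldt K ν) (σ + t * I) n = (r : ℂ) * (twistVonMangoldt K ν n * e) := by
    rw [term_eq_inv_rpow_mul _ σ t hn]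
  have hC : LSeries.term (twistVonMangoldt K ν₂) (σ + 2 * t * I) n =
      (r : ℂ) * (twistVonMangoldt K ν₂ n * e ^ 2) := by
    have := term_eq_inv_rpow_mul (twistVonMangoldt K ν₂) σ (2 * t) hn
    rw [he2] at this
    rw [← this]
    congr 1; push_cast; ring
  rw [hA, hB, hC, Complex.ofReal_re, Complex.re_ofReal_mul, Complex.re_ofReal_mul]
  -- the bracket as a sum over the ideals of norm `n`
  have hsum : 3 * (vonMangoldtNorm K n : ℂ) + 4 * (twistVonMangoldt K ν n * e) +
      twistVonMangoldt K ν₂ n * e ^ 2 =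
      ∑ B ∈ idealsOfNorm K n, (idealVonMangoldt B : ℂ) * (3 + 4 * (ν B * e) + (ν B * e) ^ 2) := by
    unfold vonMangoldtNorm twistVonMangoldt
    push_cast
    rw [Finset.mul_sum, Finset.sum_mul, Finset.sum_mul, Finset.mul_sum, ← Finset.sum_add_distrib,
      ← Finset.sum_add_distrib]
    refine Finset.sum_congr rfl fun B _ ↦ ?_
    rw [hν₂]; ring
  have hre : 0 ≤ (3 * (vonMangoldtNorm K n : ℂ) + 4 * (twistVonMangoldt K ν n * e) +
      twistVonMangoldt K ν₂ n * e ^ 2).re := by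
    rw [hsum, Complex.re_sum]
    refine Finset.sum_nonneg fun B _ ↦ ?_
    rw [Complex.re_ofReal_mul]
    refine mul_nonneg (idealVonMangoldt_nonneg B) ?_
    set w : ℂ := ν B * e with hw
    have hwn : ‖w‖ ≤ 1 := by
      rw [hw, norm_mul, he1, mul_one]; exact hν B
    have key := DirichletZFR.three_four_one_re_nonneg hwn
    have : (3 + 4 * w + w ^ 2).re = 3 + 4 * w.re + (w ^ 2).re := by
      simp [Complex.add_re, Complex.mul_re]
    rw [this]; exact key
  have hre' : (3 * (vonMangoldtNorm K n : ℂ) + 4 * (twistVonMangoldt K ν n * e) +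
      twistVonMangoldt K ν₂ n * e ^ 2).re =
      3 * vonMangoldtNorm K n + 4 * (twistVonMangoldt K ν n * e).re +
        (twistVonMangoldt K ν₂ n * e ^ 2).re := by
    simp only [Complex.add_re, Complex.mul_re, Complex.re_ofNat,
      Complex.im_ofNat, Complex.ofReal_re, Complex.ofReal_im]
    ring
  rw [hre'] at hre
  have := mul_nonneg hr0 hre
  nlinarith

/-- **Montgomery–Vaughan Lemma 11.2 over `K`**: for `σ > 1`, real `t`, `|ν| ≤ 1` and `ν₂ = ν²`,
`3 Re L(Λ_K, σ) + 4 Re L(νΛ, σ + it) + Re L(ν²Λ, σ + 2it) ≥ 0` (the field `three_four_one` of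
`TwistedZFRData` for `Λ₀ = vonMangoldtNorm K`, `Λ₁ = twistVonMangoldt ν`, `Λ₂ = twistVonMangoldt ν²`).
[cite: MontgomeryVaughan2007, Lemma 11.2] -/
theorem three_four_one (hν : ∀ I, ‖ν I‖ ≤ 1) {ν₂ : Ideal (𝓞 K) →*₀ ℂ} (hν₂ : ∀ I, ν₂ I = ν I ^ 2)
    {σ : ℝ} (hσ : 1 < σ) (t : ℝ) :
    0 ≤ 3 * (LSeries (fun n ↦ (vonMangoldtNorm K n : ℂ)) σ).re +
      4 * (LSeries (twistVonMangoldt K ν) (σ + t * I)).re +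
        (LSeries (twistVonMangoldt K ν₂) (σ + 2 * t * I)).re := by
  have hν₂' : ∀ I, ‖ν₂ I‖ ≤ 1 := fun I ↦ by
    rw [hν₂, norm_pow]; exact pow_le_one₀ (norm_nonneg _) (hν I)
  have hs1 : 1 < (σ : ℂ).re := by simp [hσ]
  have hs2 : 1 < ((σ : ℂ) + t * I).re := by simp [hσ]
  have hs3 : 1 < ((σ : ℂ) + 2 * t * I).re := by simp [hσ]
  have hA := (LSeriesSummable_vonMangoldtNorm (K := K) hs1).hasSum
  have hB := (LSeriesSummable_twistVonMangoldt hν hs2).hasSum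
  have hC := (LSeriesSummable_twistVonMangoldt hν₂' hs3).hasSum
  have hsum := ((hA.mul_left 3).add ((hB.mul_left 4).add hC)).mapL Complex.reCLM
  simp only [Complex.reCLM_apply] at hsum
  have hre : (3 * LSeries (fun n ↦ (vonMangoldtNorm K n : ℂ)) σ +
      (4 * LSeries (twistVonMangoldt K ν) (σ + t * I) +
        LSeries (twistVonMangoldt K ν₂) (σ + 2 * t * I))).re =
      3 * (LSeries (fun n ↦ (vonMangoldtNorm K n : ℂ)) σ).re +
        4 * (LSeries (twistVonMangoldt K ν) (σ + t * I)).re +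
          (LSeries (twistVonMangoldt K ν₂) (σ + 2 * t * I)).re := by
    simp only [Complex.add_re, Complex.mul_re, Complex.re_ofNat, Complex.im_ofNat]; ring
  rw [← hre]
  refine hsum.nonneg fun n ↦ ?_
  have h := re_three_four_one_terms_nonneg hν hν₂ σ t n
  simp only [Complex.add_re, Complex.mul_re, Complex.re_ofNat, Complex.im_ofNat, zero_mul, sub_zero]
  linarith [h]

end NumberField

end Literature.NumberTheory.LFunctions
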